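import Summits.AtomisticToContinuum.Crystallization.Theses.PricedLinkCensus

/-!
# Sketch — crux ideas for `PricedLinkCensus.LocalToGlobal` (stmt-AtomisticToContinuum-14232), round 1, ideator 1

First lemmas of the two idea cards `Ideas/cut-and-adapt-envelope.md` and `Ideas/flux-cell-joint-census.md`.
Statements only (`def … : Prop`), plus the two-line reductions that ARE claimed proved.
-/

noncomputable section

open scoped Classical BigOperators
open Literature.MathematicalPhysics.StatisticalMechanics Literature.Geometry.DiscreteGeometry
open Summit.AtomisticToContinuum.Crystallization.Theses.PricedLinkCensus

namespace Summit.AtomisticToContinuum.Crystallization.Cruxes.LocalToGlobal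

/-- Euclidean 3-space. -/
abbrev E3 := EuclideanSpace ℝ (Fin 3)

/-- The route's range-2 truncation `V_χ = χ·V_LJ`, `χ(r) = min(1, max(0, 4 − 2r))`. -/
def Vchi (r : ℝ) : ℝ := min 1 (max 0 (4 - 2 * r)) * lennardJones r

/-- `e* = ⨅_Q e_LJ(Q)` over periodic configurations. -/
def eStar : ℝ := ⨅ Q : PeriodicConfiguration 3, Q.energyPerParticle lennardJones

/-- `e_χ* = ⨅_Q e_χ(Q)`. -/
def eChiStar : ℝ := ⨅ Q : PeriodicConfiguration 3, Q.energyPerParticle Vchi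

/-- number of sites that are not charge-free at tolerance `1/100`. -/
def chargedCount {N : ℕ} (y : Fin N → E3) : ℕ := Nat.card {i : Fin N // ¬ IsChargeFree (1 / 100 : ℝ) y i}

/-! ## Card `cut-and-adapt-envelope` -/
namespace CutAndAdapt

/-- An admissible ADAPTATION MAP: `C²`, derivative everywhere `θ`-close (relatively) to a positive multiple
of the identity — a near-similarity WITHOUT rotation part, so that uniaxial `c/a`-type corrections along any
axis are allowed but bond-length RATIOS move by at most `≈ 2θ` — and relative curvature `≤ θ`. Such maps are
injective (monotone) for `θ < 1`. -/
def IsNearSimilarity (θ : ℝ) (φ : E3 → E3) : Prop :=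
  ContDiff ℝ 2 φ ∧ ∀ x : E3, ∃ l : ℝ, 0 < l ∧
    ‖fderiv ℝ φ x - l • ContinuousLinearMap.id ℝ E3‖ ≤ θ * l ∧ ‖fderiv ℝ (fderiv ℝ φ) x‖ ≤ θ * l

/-- The CUT-AND-ADAPT image of `y`: sites are sorted into classes `σ i`, class `k` is moved by its own
near-similarity `φ k`. -/
def adapt {N : ℕ} (σ : Fin N → ℕ) (φ : ℕ → E3 → E3) (y : Fin N → E3) : Fin N → E3 :=
  fun i => φ (σ i) (y i)

/-- Interface sites of the class assignment `σ`: some site of another class lies within `w·nn_i`. -/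
def interfaceCount {N : ℕ} (w : ℝ) (σ : Fin N → ℕ) (y : Fin N → E3) : ℕ :=
  Nat.card {i : Fin N // ∃ j : Fin N, σ j ≠ σ i ∧ dist (y i) (y j) ≤ w * nearestDist y i}

/-- `θ`-ROBUSTLY charged sites: charged (at tolerance 1/100) after EVERY single near-similarity.
The complement inside the charged sites are the `θ`-FRAGILE (threshold-marginal) charges. -/
def robustChargedCount {N : ℕ} (θ : ℝ) (y : Fin N → E3) : ℕ :=
  Nat.card {i : Fin N // ∀ φ : E3 → E3, IsNearSimilarity θ φ → ¬ IsChargeFree (1 / 100 : ℝ) (φ ∘ y) i}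

/-- **First lemma of the card (TL = CUT-AND-ADAPT DOMINATION).** After optimally re-gauging `y` by a
piecewise near-similarity (paying `β` per interface site), its TRUNCATED excess over `N e_χ*` is at most
`1/c` times its Lennard-Jones excess over `N e*`, up to `C N^{2/3}`. Continuous in `y` (no bond thresholds),
exact at the LJ minimiser (φ ≡ the affine map hcp(a*,η*) ↦ hcp(a_χ,η_χ), ‖A − I‖ ≈ 8.4e-4, no cuts), and at
polycrystals (one class per grain, cuts on grain boundaries). -/
def CutAndAdaptDomination : Prop :=
  ∃ θ w β c C : ℝ, 0 < θ ∧ 3 ≤ w ∧ 0 < β ∧ 0 < c ∧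
    ∀ (N : ℕ) (y : Fin N → E3), Function.Injective y →
      ∃ (σ : Fin N → ℕ) (φ : ℕ → E3 → E3), (∀ k, IsNearSimilarity θ (φ k)) ∧
        Function.Injective (adapt σ φ y) ∧
        c * (interactionEnergy Vchi (adapt σ φ y) + β * (interfaceCount w σ y : ℝ) - (N : ℝ) * eChiStar) ≤
          interactionEnergy lennardJones y - (N : ℝ) * eStar + C * (N : ℝ) ^ (2 / 3 : ℝ)

/-- **(i)-side: how `TruncatedCensusGap` is consumed EXACTLY.** Applied to the adapted configuration (any
class assignment, any near-similarities), the census prices every `θ`-robustly charged site of `y` that is not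
an interface site; with `β ≥ κ` the interface sites are covered by the cut penalty. Bookkeeping only (charge
status of `i` is determined by the sites within `3·nn_i`; `A` with a smaller `κ` is still `A`). -/
def RobustChargeViaCensus : Prop :=
  TruncatedCensusGap → ∀ θ : ℝ, 0 < θ → θ ≤ 1 / 1000 → ∃ κ : ℝ, 0 < κ ∧ ∀ (w β : ℝ), 3 ≤ w → κ ≤ β →
    ∀ (N : ℕ) (y : Fin N → E3) (σ : Fin N → ℕ) (φ : ℕ → E3 → E3), (∀ k, IsNearSimilarity θ (φ k)) →
      Function.Injective (adapt σ φ y) →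
        (N : ℝ) * eChiStar + κ * (robustChargedCount θ y : ℝ) ≤
          interactionEnergy Vchi (adapt σ φ y) + β * (interfaceCount w σ y : ℝ)

/-- **Fragile charge is elastic (regional near-field coercivity, the shape of
`PhononSlackCertificates.NearFieldConvexity`).** In a region `Ω` containing no `θ`-robustly charged site —
every site of `Ω` has a `(1 % + O(θ))`-marginal near-Barlow link — the half-pair site energies exceed `e*` by
`κ_f` per (fragile) charged site, up to a flat charge on the sites of `Ω` within `4·nn_i` of the outside. -/
def FragileChargePricing : Prop :=
  ∃ θ κf C : ℝ, 0 < θ ∧ 0 < κf ∧ ∀ (N : ℕ) (y : Fin N → E3), Function.Injective y →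
    ∀ Ω : Finset (Fin N),
      (∀ i ∈ Ω, ∃ φ : E3 → E3, IsNearSimilarity θ φ ∧ IsChargeFree (1 / 100 : ℝ) (φ ∘ y) i) →
        κf * (Nat.card {i : Fin N // i ∈ Ω ∧ ¬ IsChargeFree (1 / 100 : ℝ) y i} : ℝ) -
            C * (Nat.card {i : Fin N // i ∈ Ω ∧ ∃ j : Fin N, j ∉ Ω ∧
                  dist (y j) (y i) ≤ 4 * nearestDist y i} : ℝ) ≤
          ∑ i ∈ Ω, ((1 / 2 : ℝ) * (∑ j ∈ Finset.univ.erase i, lennardJones (dist (y i) (y j))) - eStar)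

/-- **Weak far field (free by periodisation + summability of `r⁻⁶`):** any set of sites has half-pair excess
`≥ −C` per boundary site. -/
def WeakFarField : Prop :=
  ∃ C : ℝ, ∀ (N : ℕ) (y : Fin N → E3), Function.Injective y → ∀ U : Finset (Fin N),
    -(C * (Nat.card {i : Fin N // i ∈ U ∧ ∃ j : Fin N, j ∉ U ∧ dist (y j) (y i) ≤ 4 * nearestDist y i} : ℝ)) ≤
      ∑ i ∈ U, ((1 / 2 : ℝ) * (∑ j ∈ Finset.univ.erase i, lennardJones (dist (y i) (y j))) - eStar)

end CutAndAdapt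

/-! ## Card `flux-cell-joint-census` -/
namespace FluxCell

/-- **First lemma / transfer `C⁺` of the card (LOCAL PRICED GAP).** There is a site functional `L`, reading
only the environment within `ρ₀·nn_i` (a finite point set) and the site, whose sum is (a) a lower bound for
the Lennard-Jones energy of EVERY finite configuration and (b) coercive: `≥ N e* + κ·#charged − C N^{2/3}`.
Candidate: `L = (1/24) Σ_j χ̃(r_ij) r_ij⁻¹² − (1/12)·T(Vor_i ∩ B(y_i, ρ₀ nn_i); q)` + typed transfers, `T`
the flux-tube (confined 8-D field) functional of card flux-tube-thomson-8d, monotone in the cell so the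
truncated cell keeps (a). -/
def LocalPricedGap : Prop :=
  ∃ (ρ₀ κ C : ℝ) (L : Finset E3 → E3 → ℝ), 0 < κ ∧
    ∀ (N : ℕ) (y : Fin N → E3), Function.Injective y →
      (N : ℝ) * (⨅ Q : PeriodicConfiguration 3, Q.energyPerParticle lennardJones) +
            κ * (Nat.card {i : Fin N // ¬ IsChargeFree (1 / 100 : ℝ) y i} : ℝ) -
            C * (N : ℝ) ^ (2 / 3 : ℝ) ≤
          ∑ i, L ((Finset.univ.filter fun j => dist (y i) (y j) ≤ ρ₀ * nearestDist y i).image y) (y i) ∧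
      ∑ i, L ((Finset.univ.filter fun j => dist (y i) (y j) ≤ ρ₀ * nearestDist y i).image y) (y i) ≤
          interactionEnergy lennardJones y

/-- `LocalPricedGap → ChargedEnergyGap` (drop the localisation). -/
theorem chargedEnergyGap_of_localPricedGap (h : LocalPricedGap) : ChargedEnergyGap := by
  obtain ⟨ρ₀, κ, C, L, hκ, h⟩ := h
  exact ⟨κ, C, hκ, fun N y hy => le_trans (h N y hy).1 (h N y hy).2⟩

/-- … hence it proves the crux (ignoring its hypothesis: in this line the census is a template, not a
hypothesis — see the card's `Dead lines`/BN2). -/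
theorem localToGlobal_of_localPricedGap (h : LocalPricedGap) : LocalToGlobal :=
  fun _ => chargedEnergyGap_of_localPricedGap h

end FluxCell

end Summit.AtomisticToContinuum.Crystallization.Cruxes.LocalToGlobal

end
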